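import Mathlib
import HarnessLib
import HarnessLib.Audit
import Summits.RiemannHypothesis.Statement
import Summits.RiemannHypothesis.RiemannHypothesis.Theses.RuelleBand
import Summits.RiemannHypothesis.RiemannHypothesis.Theorems.IntegerScrewDefs
import Summits.RiemannHypothesis.RiemannHypothesis.Theorems.IntegerScrewNestedSylvester
import Summits.RiemannHypothesis.RiemannHypothesis.Theorems.IntegerScrewFiniteExceptionInertia
import Summits.RiemannHypothesis.RiemannHypothesis.Theorems.IntegerScrewRung512
import Summits.RiemannHypothesis.RiemannHypothesis.Theorems.Splittings.CostumeDetectors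
import Summits.RiemannHypothesis.RiemannHypothesis.Theorems.Splittings.BombieriFozNoDep
import Literature.NumberTheory.LFunctions.BombieriWeilTruncations
import Literature.NumberTheory.LFunctions.WeilArchimedeanPositivityHolds

/-!
# Cell rh-split, seat rh-split-screw-bridge gen 2 — scratch for the card addendum §7
# «the ∃-tail of the screw ladder is Bombieri's FOZ door»

Typed probes for HOME/cards/SPLIT-screw-bridge.md §7 (gen-2 addendum).  Family screw:
`E_screw = IntegerScrew.riemannHypothesis_iff_screwPivot_pos : RH ↔ ∀ M ≥ 2, 0 < screwPivot M`.

* `ETailScrew` — the THRESHOLDLESS tail `∃ M₀, ∀ M ≥ M₀, d_M > 0` (PIVOT-LAW §11 «ETAIL»).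
* `ConverseInertia : ETailScrew → CofiniteCriticalLine` and `InertiaOfFoz : CofiniteCriticalLine → ETailScrew`
  — the two halves of the cell target T2 `ETail_iff_FERH`, typed over the EXISTING route decl
  `Theses.RuelleBand.CofiniteCriticalLine` (= Bombieri's FOZ, `BombieriFozNoDep.cofiniteCriticalLine_iff_foz`).
  Both are paper-DERIVED (PIVOT-LAW §11 Thm 6), NOT tree theorems; here they are HYPOTHESES.
* the splitting of record X-1 (`BombieriFozNoDep.rh_of_foz_noDep_yoshida`, landed p455498) read in screw
  clothing: modulo the named fact `Bombieri2000.corollary11` and `ConverseInertia`,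
  `RH ↔ ETailScrew ∧ NoDep ((log 2)/2)` (`rh_iff_etail_and_noDep`).
* `etail_bridge_iff` — given T2, «C ⟹ ETAIL» is literally «C ⟹ FOZ» for every `C`: the ∃-tail door of
  the screw family is FOZ and nothing else (the bridge FOZ ⟹ ETAIL is the hypothesis `InertiaOfFoz` itself); `etail_iff_rh_iff` — ETAIL is RH-equivalent iff FOZ ⟹ RH.
* `etail_detSign`, `etail_negIndex_parity_const` — kernel first rung of `ConverseInertia`: ETAIL forces all large
  levels nonsingular with eventually constant determinant sign, hence (pivot-sign rule) an eventually constant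
  PARITY of the negative index (interlacing, not in the tree, then freezes the index itself);
* `etailScrew_iff_exists_tailPiv` — dedupe: `ETailScrew` = screw-finite gen-2's `ETail` in raw form.

HONEST LABEL: SPLITTING SEARCH over kernel-typed RH-EQUIVALENCES; a splitting A ∧ B ⟹ RH is CONDITIONAL
bookkeeping unless A and B are both proved; nothing here bears on the truth of RH.
-/

set_option linter.dupNamespace false

noncomputable section

namespace Summit.RiemannHypothesis.RiemannHypothesis.Theorems.Splittings.ScrewBridgeRaw

open Literature.NumberTheory.LFunctions Literature.NumberTheory.LFunctions.Bombieri2000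
open Summit.RiemannHypothesis.RiemannHypothesis.Theses.RuelleBand
open Summit.RiemannHypothesis.RiemannHypothesis.Theorems.IntegerScrew
open Summit.RiemannHypothesis.RiemannHypothesis.Theorems.Splittings.CostumeDetectors
open Summit.RiemannHypothesis.RiemannHypothesis.Theorems.Splittings.BombieriFozNoDep

/-! ## §1 The thresholdless tail and the two halves of T2 -/

/-- RH ⟹ ETAIL (tree, trivial direction). -/
theorem etailScrew_of_rh (h : _root_.RiemannHypothesis) : (∃ M₀ : ℕ, ∀ M : ℕ, M₀ ≤ M → 0 < screwPivot M) :=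
  eventual_screwPivot_pos_of_riemannHypothesis h

/-- Every fixed-cut tail gives the ∃-tail. -/
theorem etailScrew_of_tail (H : ℕ) (h : ∀ M : ℕ, H < M → 0 < screwPivot M) : (∃ M₀ : ℕ, ∀ M : ℕ, M₀ ≤ M → 0 < screwPivot M) :=
  ⟨H + 1, fun M hM => h M (by omega)⟩

/-- DEDUPE against SPLIT-screw-finite gen-2 (`ScrewPivotSplitG2.ETail := ∃ H, TailPiv H`,
`TailPiv H := ∀ M, H ≤ M → 2 ≤ M → 0 < screwPivot M`, HOME/rh-split-screw-finite/Sketch.lean §4): the same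
statement in raw form (the guard `2 ≤ M` is absorbed by the free threshold). [folklore] -/
theorem etailScrew_iff_exists_tailPiv :
    (∃ M₀ : ℕ, ∀ M : ℕ, M₀ ≤ M → 0 < screwPivot M) ↔ ∃ H : ℕ, ∀ M : ℕ, H ≤ M → 2 ≤ M → 0 < screwPivot M := by
  constructor
  · rintro ⟨M₀, h⟩
    exact ⟨M₀, fun M hM _ => h M hM⟩
  · rintro ⟨H, h⟩
    exact ⟨max H 2, fun M hM => h M (le_of_max_le_left hM) (le_of_max_le_right hM)⟩

/-- T2 as typed in the matrix (`ETail_iff_FERH`; screw-finite gen-2 `ETailIffFERH`) is exactly the conjunction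
of the two halves. -/
theorem etail_iff_foz_iff : ((∃ M₀ : ℕ, ∀ M : ℕ, M₀ ≤ M → 0 < screwPivot M) ↔ CofiniteCriticalLine) ↔ (((∃ M₀ : ℕ, ∀ M : ℕ, M₀ ≤ M → 0 < screwPivot M) → CofiniteCriticalLine) ∧ (CofiniteCriticalLine → (∃ M₀ : ℕ, ∀ M : ℕ, M₀ ≤ M → 0 < screwPivot M))) :=
  Iff.rfl.trans ⟨fun h => ⟨h.1, h.2⟩, fun h => ⟨h.1, h.2⟩⟩

/-! ## §2 The bridge lens through the ∃-tail: the door is FOZ -/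

/-- Given T2, a bridge `C ⟹ ETAIL` is literally a bridge `C ⟹ FOZ`, for EVERY proposition `C`
(contrast `CostumeDetectors.screw_bridge_iff`: at a fixed certified cut the door is RH itself). -/
theorem etail_bridge_iff (hci : ((∃ M₀ : ℕ, ∀ M : ℕ, M₀ ≤ M → 0 < screwPivot M) → CofiniteCriticalLine)) (hiof : (CofiniteCriticalLine → (∃ M₀ : ℕ, ∀ M : ℕ, M₀ ≤ M → 0 < screwPivot M))) (C : Prop) :
    (C → (∃ M₀ : ℕ, ∀ M : ℕ, M₀ ≤ M → 0 < screwPivot M)) ↔ (C → CofiniteCriticalLine) :=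
  ⟨fun h c => hci (h c), fun h c => hiof (h c)⟩

/-- Given T2, ETAIL is RH-equivalent iff FOZ ⟹ RH (PIVOT-LAW §11 Thm 6 Remark (iii), typed). -/
theorem etail_iff_rh_iff (hci : ((∃ M₀ : ℕ, ∀ M : ℕ, M₀ ≤ M → 0 < screwPivot M) → CofiniteCriticalLine)) (hiof : (CofiniteCriticalLine → (∃ M₀ : ℕ, ∀ M : ℕ, M₀ ≤ M → 0 < screwPivot M))) :
    ((∃ M₀ : ℕ, ∀ M : ℕ, M₀ ≤ M → 0 < screwPivot M) ↔ _root_.RiemannHypothesis) ↔ (CofiniteCriticalLine → _root_.RiemannHypothesis) :=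
  ⟨fun h hfoz => h.1 (hiof hfoz), fun h => ⟨fun het => h (hci het), etailScrew_of_rh⟩⟩

/-! ## §3 X-1 in screw clothing: `ETAIL ∧ NoDep ⟹ RH` modulo `corollary11` and `ConverseInertia` -/

/-- The splitting: for any PROVED Weil positivity rung `WeilPositivityOn a` (`a > 0`), modulo the named fact
`corollary11` and the paper-derived `ConverseInertia`, ETAIL ∧ NoDep a ⟹ RH.
[cite: Bombieri2000Weil, Corollary to Thm. 11 (p. 37)] -/
theorem rh_of_etail_noDep (hci : ((∃ M₀ : ℕ, ∀ M : ℕ, M₀ ≤ M → 0 < screwPivot M) → CofiniteCriticalLine)) (h11 : corollary11) {a : ℝ} (ha : 0 < a)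
    (hW : WeilPositivityOn a) (het : (∃ M₀ : ℕ, ∀ M : ℕ, M₀ ≤ M → 0 < screwPivot M)) (hdep : NoDep a) : _root_.RiemannHypothesis :=
  rh_of_foz_noDep h11 ha hW (hci het) hdep

/-- The instance on Yoshida's proved rung `a = (log 2)/2`. -/
theorem rh_of_etail_noDep_yoshida (hci : ((∃ M₀ : ℕ, ∀ M : ℕ, M₀ ≤ M → 0 < screwPivot M) → CofiniteCriticalLine)) (h11 : corollary11) (het : (∃ M₀ : ℕ, ∀ M : ℕ, M₀ ≤ M → 0 < screwPivot M))
    (hdep : NoDep (Real.log 2 / 2)) : _root_.RiemannHypothesis :=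
  rh_of_foz_noDep_yoshida h11 (hci het) hdep

/-- Both conjuncts are RH-IMPLIED (tree: `eventual_screwPivot_pos_of_riemannHypothesis`, `noDep_of_rh`). -/
theorem etail_and_noDep_of_rh (h : _root_.RiemannHypothesis) (a : ℝ) : (∃ M₀ : ℕ, ∀ M : ℕ, M₀ ≤ M → 0 < screwPivot M) ∧ NoDep a :=
  ⟨etailScrew_of_rh h, noDep_of_rh h a⟩

/-- So, modulo `corollary11` and `ConverseInertia`, `RH ↔ ETAIL ∧ NoDep((log 2)/2)`: the screw family's
thresholdless tail IS the A-conjunct of the cell's class-(a) entry of record X-1. -/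
theorem rh_iff_etail_and_noDep (hci : ((∃ M₀ : ℕ, ∀ M : ℕ, M₀ ≤ M → 0 < screwPivot M) → CofiniteCriticalLine)) (h11 : corollary11) :
    _root_.RiemannHypothesis ↔ (∃ M₀ : ℕ, ∀ M : ℕ, M₀ ≤ M → 0 < screwPivot M) ∧ NoDep (Real.log 2 / 2) :=
  ⟨fun h => etail_and_noDep_of_rh h _, fun h => rh_of_etail_noDep_yoshida hci h11 h.1 h.2⟩

/-- Conversely the X-1 splitting gives the screw one through `InertiaOfFoz`: the two A-conjuncts are
interchangeable exactly when T2 holds. -/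
theorem etail_and_noDep_iff_foz_and_noDep (hci : ((∃ M₀ : ℕ, ∀ M : ℕ, M₀ ≤ M → 0 < screwPivot M) → CofiniteCriticalLine)) (hiof : (CofiniteCriticalLine → (∃ M₀ : ℕ, ∀ M : ℕ, M₀ ≤ M → 0 < screwPivot M))) (a : ℝ) :
    ((∃ M₀ : ℕ, ∀ M : ℕ, M₀ ≤ M → 0 < screwPivot M) ∧ NoDep a) ↔ (CofiniteCriticalLine ∧ NoDep a) :=
  ⟨fun h => ⟨hci h.1, h.2⟩, fun h => ⟨hiof h.1, h.2⟩⟩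

/-! ## §4 Kernel first rung of `ConverseInertia`: ETAIL freezes the determinant sign -/

/-- ETAIL ⟹ all large leading minors are NONSINGULAR and consecutive ones have the SAME SIGN
(a positive pivot is a ratio of two non-zero determinants of equal sign; the junk value `x/0 = 0` of a
singular level is excluded by `0 < d_M`).  This is the input of the Haynsworth step «n₋(S_{M}) = n₋(S_{M−1})
+ [d_M < 0] at nonsingular levels» which makes the negative index eventually constant under ETAIL. [folklore] -/
theorem etail_detSign (h : (∃ M₀ : ℕ, ∀ M : ℕ, M₀ ≤ M → 0 < screwPivot M)) :
    ∃ N : ℕ, ∀ n : ℕ, N ≤ n → screwDet n ≠ 0 ∧ 0 < screwDet n * screwDet (n + 1) := by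
  obtain ⟨M₀, hM₀⟩ := h
  refine ⟨M₀, fun n hn => ?_⟩
  have hpiv : 0 < screwDet (n + 1) / screwDet n := by
    rw [← screwPivot_add_two]
    exact hM₀ (n + 2) (by omega)
  rcases div_pos_iff.mp hpiv with ⟨ha, hb⟩ | ⟨ha, hb⟩
  · exact ⟨hb.ne', mul_pos hb ha⟩
  · exact ⟨hb.ne, mul_pos_of_neg_of_neg hb ha⟩

/-- Hence under ETAIL the sign of `det S_n` is eventually CONSTANT. [folklore] -/
theorem etail_detSign_const (h : (∃ M₀ : ℕ, ∀ M : ℕ, M₀ ≤ M → 0 < screwPivot M)) :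
    ∃ N : ℕ, (∀ n, N ≤ n → 0 < screwDet n) ∨ (∀ n, N ≤ n → screwDet n < 0) := by
  obtain ⟨N, hN⟩ := etail_detSign h
  refine ⟨N, ?_⟩
  rcases lt_or_gt_of_ne (hN N le_rfl).1 with hneg | hpos
  · right
    intro n hn
    induction n with
    | zero =>
      have : N = 0 := by omega
      subst this; exact hneg
    | succ k ih =>
      rcases Nat.eq_or_lt_of_le hn with h' | h'
      · rw [← h']; exact hneg
      · have hk : N ≤ k := by omega
        have hprod := (hN k hk).2
        have hkneg := ih hk
        by_contra hc
        have hc' : 0 ≤ screwDet (k + 1) := not_lt.mp hc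
        have : screwDet k * screwDet (k + 1) ≤ 0 :=
          mul_nonpos_of_nonpos_of_nonneg hkneg.le hc'
        linarith
  · left
    intro n hn
    induction n with
    | zero =>
      have : N = 0 := by omega
      subst this; exact hpos
    | succ k ih =>
      rcases Nat.eq_or_lt_of_le hn with h' | h'
      · rw [← h']; exact hpos
      · have hk : N ≤ k := by omega
        have hprod := (hN k hk).2
        have hkpos := ih hk
        by_contra hc
        have hc' : screwDet (k + 1) ≤ 0 := not_lt.mp hc
        have : screwDet k * screwDet (k + 1) ≤ 0 :=
          mul_nonpos_of_nonneg_of_nonpos hkpos.le hc'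
        linarith

/-- A nonsingular level has no zero eigenvalue (`det = ∏ eigenvalues`). [folklore] -/
theorem eigenvalues_ne_zero_of_screwDet_ne_zero {n : ℕ} (h : screwDet n ≠ 0) (i : Fin n) :
    (screwMatrix_isHermitian n).eigenvalues i ≠ 0 := by
  have hdet : screwDet n = ∏ j, (screwMatrix_isHermitian n).eigenvalues j := by
    simpa [screwDet] using (screwMatrix_isHermitian n).det_eq_prod_eigenvalues
  rw [hdet] at h
  exact (Finset.prod_ne_zero_iff.mp h) i (Finset.mem_univ i)

/-- **Kernel rung of `ConverseInertia`: under ETAIL the PARITY of the negative index `n₋(S_M)` is eventually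
CONSTANT** (`etail_detSign` + the pivot-sign rule `screwPivot_pos_iff_even_iff_even`, PIVOT-LAW §11 Thm 3(iv)).
With Cauchy interlacing for the bordered matrix (`n₋(S_{M}) ≤ n₋(S_{M+1}) ≤ n₋(S_M) + 1`, not in the tree) this
freezes `n₋` itself, i.e. gives screw-finite gen-2's `BoundedScrewIndex`; the remaining arrow to FOZ is its
`IndexTransfer` / PIVOT-LAW Lemma U. [folklore] -/
theorem etail_negIndex_parity_const (h : (∃ M₀ : ℕ, ∀ M : ℕ, M₀ ≤ M → 0 < screwPivot M)) : ∃ N : ℕ, ∀ n : ℕ, N ≤ n →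
    (Even ((Finset.univ.filter fun i => (screwMatrix_isHermitian (n + 1)).eigenvalues i < 0).card) ↔
      Even ((Finset.univ.filter fun i => (screwMatrix_isHermitian n).eigenvalues i < 0).card)) := by
  obtain ⟨N, hN⟩ := etail_detSign h
  obtain ⟨M₀, hM₀⟩ := h
  refine ⟨max N M₀, fun n hn => ?_⟩
  have hn0 : screwDet n ≠ 0 := (hN n (le_of_max_le_left hn)).1
  have hn1 : screwDet (n + 1) ≠ 0 := (hN (n + 1) (by omega)).1
  have hpiv : 0 < screwPivot (n + 2) := hM₀ (n + 2) (by omega)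
  exact (screwPivot_pos_iff_even_iff_even n (eigenvalues_ne_zero_of_screwDet_ne_zero hn0)
    (eigenvalues_ne_zero_of_screwDet_ne_zero hn1)).mp hpiv

/-! ## §5 The g0 verdict restated over the LANDED detectors (nothing re-derived) -/

/-- Fixed certified cut: every bridge to `TAIL(512)` is a bridge to RH (tree `screw_bridge_iff`). -/
example (C : Prop) : (C → ∀ M : ℕ, 512 < M → 0 < screwPivot M) ↔ (C → _root_.RiemannHypothesis) :=
  screw_bridge_iff C

/-- and the fixed-cut tail itself is RH (tree `screwTail512_iff_rh`). -/
example : (∀ M : ℕ, 512 < M → 0 < screwPivot M) ↔ _root_.RiemannHypothesis := screwTail512_iff_rh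

end Summit.RiemannHypothesis.RiemannHypothesis.Theorems.Splittings.ScrewBridgeRaw

end
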